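import Summits.NavierStokesRegularity.NavierStokesRegularity.Theorems.LerayQuarterDissipationFiniteDissipationLiouvilleEnvelopePackage
import Literature.Analysis.FluidPDE.PineauVicolOneSliceRegularityHolds
import HarnessLib

/-!
# Crux `FiniteDissipationLiouville` (stmt-NavierStokesRegularity-22144): PINEAU–VICOL'S EXPLICIT
# unsteadiness floor applies to the critical element

Theorems file of route `LerayQuarterDissipation` (seat ns-lqd-p2 g7; `--supports` the crux).
Navier–Stokes regularity is NOT proved by anything here; no summit is.

The critical element (singular member of `𝒟_{C,K_c}`, `K_c` minimal) carries the space–time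
envelope `HasTypeIDecay A(C,K_c)` (`Envelope.envelope_of_minimal`) and the scale-invariant package
(`EnvelopePackage.scaleInvariantBounds_of_minimal`: in particular a classical pressure `Q` with
`|Q(t,x)| ≤ L₀/(‖x‖ + √(−t))²`, bounded on the annulus `1/2 < ‖x‖ < 3/4`). These are EXACTLY the
standing hypotheses (1.15)–(1.16) of Pineau–Vicol 2026, Thm. 1.9 — a THEOREM of the tree
(`pineauVicol2026_oneSlice_regularity_holds`). Hence:

* `pv_unsteadiness_floor_of_minimal` — there is `δ₀ = δ₀(A) > 0` — Pineau–Vicol's explicit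
  one-slice calmness threshold for the envelope constant `max A 1` — such that every critical
  element `W` admits `T₀ = e^{−s₀} > 0` (`s₀` from PV for its pressure bound) with: at EVERY time
  `t̄ ∈ (−T₀, 0)` some `x ∈ B(0,1)` has scale-critical unsteadiness
  `‖√(−t̄)((−t̄)∂ₜW − ½W − ½(x·∇)W)(t̄,x)‖ > δ₀`. Compared with the compactness floor K1
  (`oneCalmSlice_proof`: `δ(C,K)`, ball `B(0, R√(−t))`), the threshold is now Pineau–Vicol's explicit
  function of the envelope constant.

HONEST FRAMING: `A(C,K_c)` itself comes from compactness (`Envelope`), so `δ₀` is explicit only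
modulo `A`; the localisation is the unit ball (not a similarity ball) at times `> −T₀(W)`.

References: B. Pineau, V. Vicol, arXiv:2607.09619 (2026), Thm. 1.9; KNSS 2009, Prop. 4.1.
-/

noncomputable section

-- the summit and its single sub-problem share the name (CONVENTIONS §1), as in every Theorems file
set_option linter.dupNamespace false

namespace Summit.NavierStokesRegularity.NavierStokesRegularity.Theorems.FiniteDissipationLiouville.Envelope

open MeasureTheory Set Filter Topology Metric Function
open Literature.Analysis Literature.Analysis.FluidPDE
open Summit.NavierStokesRegularity.NavierStokesRegularity.Theorems.FiniteDissipationLiouville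
open Summit.NavierStokesRegularity.NavierStokesRegularity.Theorems
open scoped ENNReal NNReal

/-- **Pineau–Vicol's explicit unsteadiness floor holds for every critical element near the apex.**
If `K_c` is minimal for `C`, there is `δ₀ > 0` (Pineau–Vicol's `δ₀(max A 1)` for the envelope
constant `A(C,K_c)`) such that every member `W` of `𝒟_{C,K_c}` singular at the apex has a time
`T₀ > 0` with: for every `t̄ ∈ (−T₀, 0)` some `x ∈ B(0,1)` carries
`δ₀ < ‖√(−t̄) • ((−t̄) • ∂ₜW(t̄,x) − ½ W(t̄,x) − ½ DW(t̄,x)[x])‖` (else Thm. 1.9 would make the apex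
regular). [cite: PineauVicol2026, Theorem 1.9 (arXiv:2607.09619 p. 8)] -/
theorem pv_unsteadiness_floor_of_minimal {C Kc : ℝ}
    (hmin : ∀ K' : ℝ, K' < Kc → ∀ w : ℝ → EuclideanSpace ℝ (Fin 3) → EuclideanSpace ℝ (Fin 3),
      IsTypeIAncientMild C w →
      (∀ s : ℝ, s < 0 → ∫⁻ x, ‖fderiv ℝ (w s) x‖ₑ ^ 2 ≤ ENNReal.ofReal (K' / Real.sqrt (-s))) →
      ¬ (∀ r > 0, ∀ M : ℝ, ∃ t ∈ Ioo (-(r ^ 2)) (0 : ℝ),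
        ∃ x ∈ ball (0 : EuclideanSpace ℝ (Fin 3)) r, M < ‖w t x‖)) :
    ∃ δ₀ > 0, ∀ (W : ℝ → EuclideanSpace ℝ (Fin 3) → EuclideanSpace ℝ (Fin 3)),
      IsTypeIAncientMild C W →
      (∀ s : ℝ, s < 0 → ∫⁻ x, ‖fderiv ℝ (W s) x‖ₑ ^ 2 ≤ ENNReal.ofReal (Kc / Real.sqrt (-s))) →
      (∀ r > 0, ∀ M : ℝ, ∃ t ∈ Ioo (-(r ^ 2)) (0 : ℝ),
        ∃ x ∈ ball (0 : EuclideanSpace ℝ (Fin 3)) r, M < ‖W t x‖) →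
      ∃ T₀ > 0, ∀ tbar ∈ Ioo (-T₀) (0 : ℝ), ∃ x ∈ ball (0 : EuclideanSpace ℝ (Fin 3)) 1,
        δ₀ < ‖Real.sqrt (-tbar) • ((-tbar) • deriv (fun τ => W τ x) tbar - (1 / 2 : ℝ) • W tbar x -
          (1 / 2 : ℝ) • fderiv ℝ (W tbar) x x)‖ := by
  obtain ⟨A, hA0, henv⟩ := envelope_of_minimal hmin
  set Cu : ℝ := max A 1 with hCu
  have hCupos : 0 < Cu := lt_of_lt_of_le one_pos (le_max_right _ _)
  obtain ⟨δ₀, hδ₀, -, hPV⟩ := pineauVicol2026_oneSlice_regularity_holds Cu hCupos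
  refine ⟨δ₀, hδ₀, fun W hW hlaw hsing => ?_⟩
  -- the scale-invariant package: classical pressure with `|Q| ≤ L/(‖x‖+√(−t))²`
  obtain ⟨Q, hQ, hSIB⟩ := scaleInvariantBounds_of_minimal hmin hW hlaw hsing
  obtain ⟨L, hL⟩ := hSIB 0
  have hL0 : 0 ≤ L := by
    have h1 := (hL (-1) (by norm_num) 0).1
    have hden : 0 < (‖(0 : EuclideanSpace ℝ (Fin 3))‖ + Real.sqrt (-(-1 : ℝ))) ^ (1 + 0) := by
      rw [norm_zero, zero_add, neg_neg, Real.sqrt_one]; norm_num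
    by_contra hneg
    push Not at hneg
    have : L / (‖(0 : EuclideanSpace ℝ (Fin 3))‖ + Real.sqrt (-(-1 : ℝ))) ^ (1 + 0) < 0 :=
      div_neg_of_neg_of_pos hneg hden
    linarith [norm_nonneg (iteratedFDeriv ℝ 0 (W (-1)) 0)]
  set Cp : ℝ := 4 * L + 1 with hCp
  have hCppos : 0 < Cp := by rw [hCp]; positivity
  obtain ⟨s₀, hs₀, hPV'⟩ := hPV Cp hCppos
  -- the region solution on `[−1,0) × B₁`
  have hreg : IsClassicalNSSolutionOnRegion (Ico (-1 : ℝ) 0 ×ˢ ball (0 : EuclideanSpace ℝ (Fin 3)) 1) 1 0 W Q := by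
    refine hQ.onRegion.mono (prod_mono Ico_subset_Iio_self (subset_univ _)) ?_
    intro t x htx
    obtain ⟨ht, hx⟩ := mem_prod.1 htx
    rw [timeSection_prod _ hx]
    exact uniqueDiffOn_Ico (-1 : ℝ) 0 t ht
  -- (1.15): the envelope
  have h15 : ∀ t ∈ Ico (-1 : ℝ) 0, ∀ x ∈ ball (0 : EuclideanSpace ℝ (Fin 3)) 1,
      ‖W t x‖ ≤ Cu / (Real.sqrt (-t) + ‖x‖) := by
    intro t ht x _
    have hden : 0 < ‖x‖ + Real.sqrt (-t) :=
      add_pos_of_nonneg_of_pos (norm_nonneg _) (Real.sqrt_pos.2 (neg_pos.2 ht.2))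
    refine (henv W hW hlaw hsing t ht.2 x).trans ?_
    rw [add_comm (Real.sqrt (-t))]
    exact div_le_div_of_nonneg_right (le_max_left _ _) hden.le
  -- (1.16): the pressure on the annulus
  have h16 : ∀ t ∈ Ico (-1 : ℝ) 0, ∀ x : EuclideanSpace ℝ (Fin 3), 1 / 2 < ‖x‖ → ‖x‖ < 3 / 4 →
      |Q t x| ≤ Cp := by
    intro t ht x hx1 _
    have h1 := (hL t ht.2 x).2.1
    rw [norm_iteratedFDeriv_zero, Real.norm_eq_abs] at h1
    have hst : 0 ≤ Real.sqrt (-t) := Real.sqrt_nonneg _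
    have hxpos : 0 < ‖x‖ := by linarith
    have h2 : L / (‖x‖ + Real.sqrt (-t)) ^ (2 + 0) ≤ L / ‖x‖ ^ 2 := by
      rw [show (2 + 0 : ℕ) = 2 by norm_num]
      exact div_le_div_of_nonneg_left hL0 (by positivity) (by nlinarith)
    have h3 : L / ‖x‖ ^ 2 ≤ 4 * L := by
      rw [div_le_iff₀ (by positivity)]
      have hx2 : (1 / 4 : ℝ) ≤ ‖x‖ ^ 2 := by nlinarith
      nlinarith [mul_le_mul_of_nonneg_left hx2 hL0]
    rw [hCp]; linarith
  -- the floor: a calm slice would make the apex regular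
  refine ⟨Real.exp (-s₀), Real.exp_pos _, fun tbar htbar => ?_⟩
  by_contra hcalm
  push Not at hcalm
  have htbar1 : -1 < tbar := by
    have : Real.exp (-s₀) ≤ Real.exp 0 := Real.exp_le_exp.2 (by linarith)
    rw [Real.exp_zero] at this
    linarith [htbar.1]
  -- PV's calmness hypothesis (its time derivative within the region is the genuine one)
  have hcalm' : ∀ x ∈ ball (0 : EuclideanSpace ℝ (Fin 3)) 1,
      ‖Real.sqrt (-tbar) • ((-tbar) • timeDerivOn (Ico (-1 : ℝ) 0 ×ˢ ball (0 : EuclideanSpace ℝ (Fin 3)) 1)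
        W tbar x - (1 / 2 : ℝ) • W tbar x - (1 / 2 : ℝ) • fderiv ℝ (W tbar) x x)‖ ≤ δ₀ := by
    intro x hx
    have e : timeDerivOn (Ico (-1 : ℝ) 0 ×ˢ ball (0 : EuclideanSpace ℝ (Fin 3)) 1) W tbar x =
        deriv (fun τ => W τ x) tbar := by
      rw [timeDerivOn_prod _ _ _ hx, timeDerivWithin_apply,
        derivWithin_of_mem_nhds (Ico_mem_nhds htbar1 htbar.2)]
    rw [e]
    exact hcalm x hx
  obtain ⟨r, hr, M, hM⟩ := hPV' W Q hreg h15 h16 tbar htbar.1 htbar.2 hcalm'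
  obtain ⟨t, ht, x, hx, hbig⟩ := hsing r hr M
  have := hM t ht.1 ht.2 x hx
  linarith

end Summit.NavierStokesRegularity.NavierStokesRegularity.Theorems.FiniteDissipationLiouville.Envelope

end
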